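import Summits.ResolutionOfSingularities.ResolutionOfSingularities.Theorems.FrobeniusClosingSteerInsepStepMaximalIdealFour
import Summits.ResolutionOfSingularities.ResolutionOfSingularities.Theorems.FrobeniusClosingSteerInsepStepReadingTools
import Summits.ResolutionOfSingularities.ResolutionOfSingularities.Theorems.FrobeniusClosingSteerInsepStepReadings
import Summits.ResolutionOfSingularities.ResolutionOfSingularities.Theorems.FrobeniusClosingSteerInsepStepPolyLemmaTwo
import Literature.AlgebraicGeometry.Resolution.RegularLocalRingsQuotient
import HarnessLib

/-!
# Steer / LEMMA I kernel, file F6c: THE READING MACHINE AT A DEGREE-FOUR NEAR POINT — `R̄ = S₁ ⧸ (X)`, `R' = S₁ ⧸ (X, q₂)` and (PL₂) in reading form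

OURS (campaign res-hironaka, rung L ★L-G4, slot W4.1, crux `Steer` stmt-ResolutionOfSingularities-16345; res-L0-w41-plan-1 RULING 155a, kernel of
res-L0-w41-idea-3's LEMMA I `InsepStepNotIsolated`, degree-FOUR near point; res-L0-w41-stub-3 g7, blueprint `KERNEL-BLUEPRINT-LemmaI.md` 693d33707585fe97
§2/§4 Case C; replaces the role of no printed item; NOT a statement of the manuscript under review [claim: Hironaka2017, status: under-review]; AI review is
weaker than expert review). Theses-free, definition-free.

* `layer₂_add_single` — exponent bookkeeping on `Fin 3`;
* `read_of_degFour` — with `𝔪₁ = (X, q₁, q₂)` (`…MaximalIdealFour`): `X ∉ 𝔪₁²`, the quotient `S₁ ⧸ (X)` is regular of embedding dimension `2` with parameters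
  `q̄₁, q̄₂` (`q̄₂ ∉ 𝔫²`, so `q̄₂` cancels one order at a time), `S₁ ⧸ (X, q₂)` is a regular local domain with `𝔪 = (q̄₁) ≠ 0`, and `LemmaI.polyLemma_two`
  applies: a nested `G ∈ (S₀[Z'])[T]` with `deg_{Z'} coeff_j G < 2N − j` whose value `G(t, z')` is congruent mod `(X)` to an element of `𝔪₁^N` has all its
  coefficients in `𝔪₀`.
[cite: Matsumura1987, Thm. 14.2, Thm. 17.10] [cite: ZariskiSamuel1960, Ch. VIII §1 Thm. 1] [folklore]
-/

noncomputable section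

-- single-problem summit: the doubled namespace component `ResolutionOfSingularities` is forced
set_option linter.dupNamespace false

namespace Summit.ResolutionOfSingularities.ResolutionOfSingularities.Theorems.SwitchingDichotomy.LemmaI

open IsLocalRing MvPolynomial Literature.AlgebraicGeometry.Resolution
open Summit.ResolutionOfSingularities.ResolutionOfSingularities.Theorems.SwitchingDichotomy

variable {L : Type} [Field L] {S₀ S₁ : Subring L}

/-- Exponent bookkeeping: `(n − j − k, j, k) + (0,1,0) = ((n+1) − (j+1) − k, j+1, k)` and the `Z'`-analogue. [folklore] -/
theorem layer₂_add_single (n j k : ℕ) :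
    Finsupp.single (0 : Fin 3) (n - j - k) + Finsupp.single 1 j + Finsupp.single 2 k + Finsupp.single 1 1 =
      Finsupp.single (0 : Fin 3) (n + 1 - (j + 1) - k) + Finsupp.single 1 (j + 1) + Finsupp.single 2 k ∧
    Finsupp.single (0 : Fin 3) (n - j - k) + Finsupp.single 1 j + Finsupp.single 2 k + Finsupp.single 2 1 =
      Finsupp.single (0 : Fin 3) (n + 1 - j - (k + 1)) + Finsupp.single 1 j + Finsupp.single 2 (k + 1) := by
  constructor
  · rw [show n + 1 - (j + 1) - k = n - j - k by omega, add_assoc, add_comm (Finsupp.single 2 k), ← add_assoc, add_assoc _ (Finsupp.single 1 j),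
      ← Finsupp.single_add]
  · rw [show n + 1 - j - (k + 1) = n - j - k by omega, add_assoc, ← Finsupp.single_add]

/-- **The reading machine at a degree-four near point.** With `𝔪₁ = (X, q₁, q₂)` (`qᵢ` the inseparable minimal polynomials): `X ∉ 𝔪₁²`, and
the bivariate polynomial lemma (`LemmaI.polyLemma_two` in `R̄ = S₁ ⧸ (X)` with auxiliary quotient `S₁ ⧸ (X, q₂)`) in READING form: a nested polynomial
`G ∈ (S₀[Z'])[T]` with `deg_{Z'} coeff_j G < 2N − j` whose value `G(t, z')` is congruent mod `(X)` to an element of `𝔪₁^N` has all coefficients in `𝔪₀`.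
[cite: Matsumura1987, Thm. 14.2, Thm. 17.10] [folklore] -/
theorem read_of_degFour [CharP L 2] [IsLocalRing S₀] [IsLocalRing S₁] (hreg₁ : IsRegularLocalRing S₁) (hdim₁ : ringKrullDim S₁ = 3)
    (hQT : IsQuadraticTransform S₀ S₁) (h : S₀ ≤ S₁)
    {X Y Z : S₀} (hXYZ : Ideal.span {X, Y, Z} = maximalIdeal S₀) (hX0 : (X : L) ≠ 0) (hB : blowupRing S₀ (X : L) ≤ S₁)
    (hfrac : ∀ w ∈ S₁, ∃ a ∈ blowupRing S₀ (X : L), ∃ b ∈ blowupRing S₀ (X : L), b⁻¹ ∈ S₁ ∧ w = a / b)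
    (t₁ z₁ : S₁) (ht₁ : (t₁ : L) = Y / X) (hz₁ : (z₁ : L) = Z / X)
    (ht : ∀ a : S₀, t₁ - Subring.inclusion h a ∉ maximalIdeal S₁)
    (hz : ∀ c e : S₀, z₁ - Subring.inclusion h c - Subring.inclusion h e * t₁ ∉ maximalIdeal S₁)
    (ℓ₁ ℓ₂ : S₀) (hq₁ : t₁ ^ 2 - Subring.inclusion h ℓ₁ ∈ maximalIdeal S₁) (hq₂ : z₁ ^ 2 - Subring.inclusion h ℓ₂ ∈ maximalIdeal S₁) :
    Subring.inclusion h X ∉ maximalIdeal S₁ ^ 2 ∧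
    ∀ (N : ℕ) (G : Polynomial (Polynomial S₀)), (∀ j, (G.coeff j).degree < ((2 * N - j : ℕ) : WithBot ℕ)) →
      ∀ a ∈ maximalIdeal S₁ ^ N, G.eval₂ (Polynomial.eval₂RingHom (Subring.inclusion h) z₁) t₁ - a ∈ Ideal.span {Subring.inclusion h X} →
        ∀ j k, (G.coeff j).coeff k ∈ maximalIdeal S₀ := by
  classical
  haveI := hreg₁
  set ι := Subring.inclusion h with hι
  have hdom : SubringDominates S₀ S₁ := hQT.dominates
  obtain ⟨hXm, -, -⟩ := mem_of_span_triple_eq hXYZ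
  set q₁ : S₁ := t₁ ^ 2 - ι ℓ₁ with hq₁def
  set q₂ : S₁ := z₁ ^ 2 - ι ℓ₂ with hq₂def
  set I : Ideal S₁ := Ideal.span {ι X} with hI
  have hXI : ι X ∈ I := Ideal.mem_span_singleton_self _
  have hmapm0 : (maximalIdeal S₀).map ι ≤ I := map_maximalIdeal_le_span_exc h hB hX0
  have hm0I : ∀ a ∈ maximalIdeal S₀, ι a ∈ I := fun a ha => hmapm0 (Ideal.mem_map_of_mem ι ha)
  have hm01 : ∀ a ∈ maximalIdeal S₀, ι a ∈ maximalIdeal S₁ := fun a ha => (inclusion_mem_maximalIdeal_iff hdom a).mpr ha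
  have hXm₁ : ι X ∈ maximalIdeal S₁ := hm01 X hXm

  -- ### structure of `𝔪₁`; the quotients `R̄ = S₁ ⧸ (X)` and `R' = S₁ ⧸ (X, q₂)` (F2c)
  have hm1 : maximalIdeal S₁ = Ideal.span {ι X, q₁, q₂} :=
    maximalIdeal_eq_span_triple_four hQT hdom hXYZ hX0 hB hfrac t₁ z₁ ht₁ hz₁ ht hz ℓ₁ ℓ₂ hq₁ hq₂
  have hm1' : Ideal.span {ι X, q₂, q₁} = maximalIdeal S₁ := by rw [span_triple_swap]; exact hm1.symm
  have h31 : (maximalIdeal S₁).spanFinrank = 3 := spanFinrank_eq_three hdim₁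
  have hx1 : Ideal.span (Set.range ![ι X, q₁, q₂]) = maximalIdeal S₁ := by rw [span_range_vec3]; exact hm1.symm
  have hX2 : ι X ∉ maximalIdeal S₁ ^ 2 := by simpa using rsop_not_mem_sq h31 ![ι X, q₁, q₂] hx1 0
  have hIm : I ≤ maximalIdeal S₁ := by rw [hI, Ideal.span_le, Set.singleton_subset_iff]; exact hXm₁
  haveI hRreg : IsRegularLocalRing (S₁ ⧸ I) := (IsRegularLocalRing.quotient_span_singleton hXm₁ hX2).1
  set mk : S₁ →+* S₁ ⧸ I := Ideal.Quotient.mk I with hmk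
  have h𝔫 : maximalIdeal (S₁ ⧸ I) = Ideal.span {mk q₁, mk q₂} := by
    rw [← IsLocalRing.map_maximalIdeal_of_surjective mk Ideal.Quotient.mk_surjective, hm1, Ideal.map_span,
      Set.image_insert_eq, Set.image_insert_eq, Set.image_singleton,
      show mk (ι X) = 0 from Ideal.Quotient.eq_zero_iff_mem.mpr hXI, Ideal.span_insert_zero]
  have h𝔫2 : (maximalIdeal (S₁ ⧸ I)).spanFinrank = 2 := by
    have h2 : (maximalIdeal (S₁ ⧸ I)).spanFinrank + 1 = (maximalIdeal S₁).spanFinrank :=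
      IsRegularLocalRing.spanFinrank_maximalIdeal_quotient_span_singleton hXm₁ hX2
    rw [h31] at h2
    omega
  have hx𝔫 : Ideal.span (Set.range ![mk q₁, mk q₂]) = maximalIdeal (S₁ ⧸ I) := by
    rw [Matrix.range_cons_cons_empty]; exact h𝔫.symm
  have hq₂2 : mk q₂ ∉ maximalIdeal (S₁ ⧸ I) ^ 2 := by simpa using rsop_not_mem_sq h𝔫2 ![mk q₁, mk q₂] hx𝔫 1
  set I' : Ideal S₁ := Ideal.span {ι X, q₂} with hI'
  have hII' : I ≤ I' := Ideal.span_mono (by simp)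
  have hI'm : I' ≤ maximalIdeal S₁ := by
    rw [hI', Ideal.span_le]
    rintro w hw
    simp only [Set.mem_insert_iff, Set.mem_singleton_iff] at hw
    rcases hw with rfl | rfl
    · exact hXm₁
    · exact hq₂
  haveI hR'reg : IsRegularLocalRing (S₁ ⧸ I') := isRegularLocalRing_quotient_pair h31 (ι X) q₂ q₁ hm1'
  haveI : IsDomain (S₁ ⧸ I') := isDomain_of_isRegularLocalRing _
  set mk' : S₁ →+* S₁ ⧸ I' := Ideal.Quotient.mk I' with hmk'
  set π : S₁ ⧸ I →+* S₁ ⧸ I' := Ideal.Quotient.factor hII' with hπ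
  have hπmk : ∀ w, π (mk w) = mk' w := fun w => Ideal.Quotient.factor_mk hII' w
  have hm' : maximalIdeal (S₁ ⧸ I') = Ideal.span {mk' q₁} := maximalIdeal_quotient_eq_span (ι X) q₂ q₁ hm1'
  have hq₁0 : mk' q₁ ≠ 0 := mk_ne_zero_of_spanFinrank (ι X) q₂ q₁ hm1' h31
  -- ### the bivariate polynomial lemma in `R̄`
  set ῑ : S₀ →+* S₁ ⧸ I := mk.comp ι with hῑ
  have hῑ0 : ∀ m ∈ maximalIdeal S₀, ῑ m = 0 := fun m hm => Ideal.Quotient.eq_zero_iff_mem.mpr (hm0I m hm)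
  have hv₁ : mk t₁ ^ 2 - ῑ ℓ₁ = mk q₁ := by rw [hῑ, RingHom.comp_apply, ← map_pow, ← map_sub]
  have hv₂ : mk z₁ ^ 2 - ῑ ℓ₂ = mk q₂ := by rw [hῑ, RingHom.comp_apply, ← map_pow, ← map_sub]
  have PL : ∀ (N : ℕ) (G : Polynomial (Polynomial S₀)), (∀ j, (G.coeff j).degree < ((2 * N - j : ℕ) : WithBot ℕ)) →
      G.eval₂ (Polynomial.eval₂RingHom ῑ (mk z₁)) (mk t₁) ∈ maximalIdeal (S₁ ⧸ I) ^ N → ∀ j k, (G.coeff j).coeff k ∈ maximalIdeal S₀ := by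
    refine polyLemma_two ῑ hῑ0 (mk t₁) (mk z₁) ℓ₁ ℓ₂ (by rw [hv₁, hv₂, h𝔫]) π ?_ ?_ ?_ ?_ ?_ ?_
    · rw [hv₂, hπmk]; exact Ideal.Quotient.eq_zero_iff_mem.mpr (Ideal.subset_span (by simp))
    · rw [hv₁, hπmk, hm']
    · rw [hv₁, hπmk]; exact hq₁0
    · intro w hw
      obtain ⟨w, rfl⟩ := Ideal.Quotient.mk_surjective w
      change π (mk w) ∈ _ at hw
      rw [hπmk, ← IsLocalRing.map_maximalIdeal_of_surjective mk' Ideal.Quotient.mk_surjective, mk_mem_map_maximalIdeal_iff hI'm] at hw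
      change mk w ∈ _
      rw [← IsLocalRing.map_maximalIdeal_of_surjective mk Ideal.Quotient.mk_surjective]
      exact Ideal.mem_map_of_mem _ hw
    · intro N w hw
      rw [hv₂] at hw
      exact mem_pow_of_exc_mul_mem hq₂2 hw
    · intro a₀ a₁ b₀ b₁ hab
      refine mem_of_bilinear_mem hdom t₁ z₁ ht hz ℓ₁ hq₁ a₀ a₁ b₀ b₁ ?_
      rw [hῑ] at hab
      simp only [RingHom.comp_apply, ← map_mul, ← map_add] at hab
      rwa [← IsLocalRing.map_maximalIdeal_of_surjective mk Ideal.Quotient.mk_surjective, mk_mem_map_maximalIdeal_iff hIm] at hab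
  -- reading: `EV G ≡ a mod I`, `a ∈ 𝔪₁^N`
  have hcomp : mk.comp (Polynomial.eval₂RingHom ι z₁) = Polynomial.eval₂RingHom ῑ (mk z₁) :=
    Polynomial.ringHom_ext (fun c => by simp [hῑ]) (by simp)
  have read : ∀ {N : ℕ} {G : Polynomial (Polynomial S₀)}, (∀ j, (G.coeff j).degree < ((2 * N - j : ℕ) : WithBot ℕ)) →
      ∀ {a : S₁}, a ∈ maximalIdeal S₁ ^ N → G.eval₂ (Polynomial.eval₂RingHom ι z₁) t₁ - a ∈ I →
        ∀ j k, (G.coeff j).coeff k ∈ maximalIdeal S₀ := by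
    intro N G hdeg a ha hcong
    refine PL N G hdeg ?_
    rw [← hcomp, ← Polynomial.hom_eval₂, (Ideal.Quotient.eq).mpr hcong,
      ← IsLocalRing.map_maximalIdeal_of_surjective mk Ideal.Quotient.mk_surjective, ← Ideal.map_pow]
    exact Ideal.mem_map_of_mem _ ha
  exact ⟨hX2, fun N G hdeg a ha hcong => read hdeg ha hcong⟩

end Summit.ResolutionOfSingularities.ResolutionOfSingularities.Theorems.SwitchingDichotomy.LemmaI

end
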